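import Mathlib
import Summits.Ventures.HodgeRepro2.T5DegreeOneNumberField

/-!
# T5DegreeOneEmbeddings — embeddings `F → ℚ_p` and the degree-one primes above `p`

Tier-5 support (seat p7, cell pub-hodge-repro2) for route/T5-CHECK-G-p7.md §12.2 row P1.5
(«the p-adic places induced by elements in Σ via ι_p») and T5-LEAN-p7.md §22 (b)(iii), in the
EMBEDDING vocabulary of print (row 32's `T5OrdinaryCMType` spoke the Galois-group dialect).

For a number field `F` and a rational prime `p`:

* every degree-one prime `w` above `p` gives an embedding `embedding w : F →+* ℚ_[p]`
  (the `toPadic` of the chain T5DegreeOne*, rows 50–54);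
* conversely every ring homomorphism `φ : F →+* ℚ_[p]` induces a prime
  `inducedPrime φ = {x ∈ 𝓞 F | ‖φ x‖ < 1}` — it lies over `p` and HAS DEGREE ONE
  (`inducedPrime_liesOver`, `ramificationIdx_inducedPrime`, `inertiaDeg_inducedPrime`), the
  integrality `‖φ x‖ ≤ 1` on `𝓞 F` being automatic (`norm_apply_algebraMap_le_one`);
* distinct degree-one primes give distinct embeddings (`embedding_ne_of_ne`).

The second file of the chain, `T5EmbeddingPrimeEquiv`, shows that the two constructions are
inverse to each other.  Nothing about CM types or Hecke characters is asserted.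
-/

namespace Summit.Ventures.HodgeRepro2.T5DegreeOneEmbeddings

open IsDedekindDomain NumberField

variable {F : Type*} [Field F] {p : ℕ} [hp : Fact p.Prime]

/-- The ideal `(p) ⊆ ℤ` is maximal. -/
theorem isMaximal_span_p : (Ideal.span {(p : ℤ)}).IsMaximal :=
  PrincipalIdealRing.isMaximal_of_irreducible (Nat.prime_iff_prime_int.mp hp.out).irreducible

/-- The ideal `(p) ⊆ ℤ` is not zero. -/
theorem span_p_ne_bot : Ideal.span {(p : ℤ)} ≠ ⊥ := by
  rw [Ne, Ideal.span_singleton_eq_bot]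
  exact_mod_cast hp.out.ne_zero

section embedding

variable [NumberField F] (w : HeightOneSpectrum (𝓞 F))

/-- The embedding `F →+* ℚ_[p]` attached to a degree-one prime `w` above `p`: the `toPadic` of
row 51, restricting to `F ⊆ F_w ≃ ℚ_p` (row 54). -/
noncomputable def embedding (p : ℕ) [hp : Fact p.Prime]
    [hw : w.asIdeal.LiesOver (Ideal.span {(p : ℤ)})]
    (hdeg : w.asIdeal.ramificationIdx ℤ * w.asIdeal.inertiaDeg ℤ = 1) : F →+* ℚ_[p] :=
  T5DegreeOnePadic.toPadic w (T5DegreeOneNumberField.natCast_mem w p)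
    (T5DegreeOneNumberField.natCast_notMem_sq w p hdeg)
    (T5DegreeOneNumberField.exists_int_sub_mem w p hdeg)

variable (p) [hw : w.asIdeal.LiesOver (Ideal.span {(p : ℤ)})]
  (hdeg : w.asIdeal.ramificationIdx ℤ * w.asIdeal.inertiaDeg ℤ = 1)

/-- On the integers the embedding is the `toPadicInt` of row 50. -/
theorem embedding_algebraMap (x : 𝓞 F) :
    embedding w p hdeg (algebraMap (𝓞 F) F x) =
      ((T5DegreeOnePadicInt.toPadicInt w.ne_bot (T5DegreeOneNumberField.natCast_mem w p)
        (T5DegreeOneNumberField.natCast_notMem_sq w p hdeg)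
        (T5DegreeOneNumberField.exists_int_sub_mem w p hdeg)) x : ℚ_[p]) :=
  T5DegreeOnePadic.toPadic_algebraMap w _ _ _ x

/-- On the integers the embedding has norm `≤ 1`. -/
theorem norm_embedding_algebraMap_le_one (x : 𝓞 F) :
    ‖embedding w p hdeg (algebraMap (𝓞 F) F x)‖ ≤ 1 := by
  rw [embedding_algebraMap]
  exact PadicInt.norm_le_one _

/-- The prime `w` is recovered from its embedding: `x ∈ w ↔ ‖embedding w x‖ < 1`. -/
theorem norm_embedding_algebraMap_lt_one_iff (x : 𝓞 F) :
    ‖embedding w p hdeg (algebraMap (𝓞 F) F x)‖ < 1 ↔ x ∈ w.asIdeal := by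
  rw [embedding_algebraMap]
  exact T5DegreeOnePadicInt.norm_toPadicInt_lt_one_iff w.ne_bot _ _ _ x

/-- The embedding is injective (a ring homomorphism of fields). -/
theorem embedding_injective : Function.Injective (embedding w p hdeg) :=
  (embedding w p hdeg).injective

end embedding

/-- Distinct degree-one primes above `p` give distinct embeddings `F → ℚ_p`. -/
theorem embedding_ne_of_ne [NumberField F] (w w' : HeightOneSpectrum (𝓞 F))
    [hw : w.asIdeal.LiesOver (Ideal.span {(p : ℤ)})]
    [hw' : w'.asIdeal.LiesOver (Ideal.span {(p : ℤ)})]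
    (hdeg : w.asIdeal.ramificationIdx ℤ * w.asIdeal.inertiaDeg ℤ = 1)
    (hdeg' : w'.asIdeal.ramificationIdx ℤ * w'.asIdeal.inertiaDeg ℤ = 1) (hne : w ≠ w') :
    embedding w p hdeg ≠ embedding w' p hdeg' := by
  intro heq
  apply hne
  apply HeightOneSpectrum.ext
  have hle : w.asIdeal ≤ w'.asIdeal := by
    intro x hx
    rw [← norm_embedding_algebraMap_lt_one_iff p w' hdeg', ← heq,
      norm_embedding_algebraMap_lt_one_iff p w hdeg]
    exact hx
  exact w.isMaximal.eq_of_le w'.isMaximal.ne_top hle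

section induced

variable (φ : F →+* ℚ_[p])

/-- Integrality: a ring homomorphism `F → ℚ_p` maps the ring of integers into `ℤ_p`. -/
theorem norm_apply_algebraMap_le_one (x : 𝓞 F) : ‖φ (algebraMap (𝓞 F) F x)‖ ≤ 1 := by
  have h1 : IsIntegral ℤ (algebraMap (𝓞 F) F x) := RingOfIntegers.isIntegral_coe x
  have h2 : IsIntegral ℤ (φ (algebraMap (𝓞 F) F x)) := h1.map φ.toIntAlgHom
  have h3 : IsIntegral ℤ_[p] (φ (algebraMap (𝓞 F) F x)) := h2.tower_top
  obtain ⟨y, hy⟩ := IsIntegrallyClosed.isIntegral_iff.mp h3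
  rw [← hy, PadicInt.algebraMap_apply]
  exact PadicInt.norm_le_one y

/-- The restriction of `φ` to the integers, as a ring homomorphism `𝓞 F →+* ℤ_[p]`. -/
noncomputable def restrict : 𝓞 F →+* ℤ_[p] where
  toFun x := ⟨φ (algebraMap (𝓞 F) F x), norm_apply_algebraMap_le_one φ x⟩
  map_one' := Subtype.ext (by simp)
  map_mul' x y := Subtype.ext (by simp)
  map_zero' := Subtype.ext (by simp)
  map_add' x y := Subtype.ext (by simp)

/-- `restrict φ x = φ x` in `ℚ_p`. -/
@[simp]
theorem coe_restrict (x : 𝓞 F) : (restrict φ x : ℚ_[p]) = φ (algebraMap (𝓞 F) F x) := rfl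

/-- The ideal of `𝓞 F` induced by `φ`: the pull-back of the maximal ideal of `ℤ_p`, i.e.
`{x | ‖φ x‖ < 1}`. -/
noncomputable def inducedIdeal : Ideal (𝓞 F) :=
  (IsLocalRing.maximalIdeal ℤ_[p]).comap (restrict φ)

/-- `x ∈ inducedIdeal φ ↔ ‖φ x‖ < 1`. -/
theorem mem_inducedIdeal_iff (x : 𝓞 F) :
    x ∈ inducedIdeal φ ↔ ‖φ (algebraMap (𝓞 F) F x)‖ < 1 := by
  rw [inducedIdeal, Ideal.mem_comap, IsLocalRing.mem_maximalIdeal, PadicInt.mem_nonunits,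
    PadicInt.norm_def, coe_restrict]

/-- The induced ideal is prime (the pull-back of the maximal ideal of `ℤ_p`). -/
instance inducedIdeal_isPrime : (inducedIdeal φ).IsPrime :=
  Ideal.IsPrime.comap _

/-- `p` lies in the induced ideal (`‖φ p‖ = ‖p‖ = p⁻¹ < 1`). -/
theorem natCast_mem_inducedIdeal : (p : 𝓞 F) ∈ inducedIdeal φ := by
  rw [mem_inducedIdeal_iff, map_natCast, map_natCast, Padic.norm_p]
  exact inv_lt_one_of_one_lt₀ (by exact_mod_cast hp.out.one_lt)

/-- The induced prime lies over `(p)`. -/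
theorem under_inducedIdeal : (inducedIdeal φ).under ℤ = Ideal.span {(p : ℤ)} := by
  ext a
  rw [Ideal.mem_under, mem_inducedIdeal_iff, Ideal.mem_span_singleton]
  have : (algebraMap (𝓞 F) F) ((algebraMap ℤ (𝓞 F)) a) = (a : F) := by
    rw [← IsScalarTower.algebraMap_apply]; rfl
  rw [this, map_intCast, Padic.norm_intCast_lt_one_iff]

/-- The induced ideal lies over `(p)`. -/
instance inducedIdeal_liesOver : (inducedIdeal φ).LiesOver (Ideal.span {(p : ℤ)}) :=
  ⟨(under_inducedIdeal φ).symm⟩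

/-- The image of the induced ideal under `restrict φ` lies in the maximal ideal `(p)` of `ℤ_p`. -/
theorem map_restrict_inducedIdeal_le :
    (inducedIdeal φ).map (restrict φ) ≤ Ideal.span {(p : ℤ_[p])} := by
  rw [← PadicInt.maximalIdeal_eq_span_p, Ideal.map_le_iff_le_comap]
  exact le_rfl

/-- `restrict φ` maps the `n`-th power of the induced ideal into `(pⁿ) ⊆ ℤ_p`. -/
theorem restrict_mem_span_pow_of_mem_pow (n : ℕ) (x : 𝓞 F) (hx : x ∈ inducedIdeal φ ^ n) :
    restrict φ x ∈ Ideal.span {(p : ℤ_[p]) ^ n} := by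
  rw [← Ideal.span_singleton_pow]
  have hmap : (inducedIdeal φ ^ n).map (restrict φ) ≤ Ideal.span {(p : ℤ_[p])} ^ n := by
    rw [Ideal.map_pow]
    exact Ideal.pow_right_mono (map_restrict_inducedIdeal_le φ) n
  exact hmap (Ideal.mem_map_of_mem _ hx)

/-- Elements of the `n`-th power of the induced ideal have norm `≤ p^{-n}` under `φ`. -/
theorem norm_apply_le_of_mem_pow (n : ℕ) (x : 𝓞 F) (hx : x ∈ inducedIdeal φ ^ n) :
    ‖φ (algebraMap (𝓞 F) F x)‖ ≤ (p : ℝ) ^ (-(n : ℤ)) := by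
  have h := restrict_mem_span_pow_of_mem_pow φ n x hx
  rw [← PadicInt.norm_le_pow_iff_mem_span_pow] at h
  rw [PadicInt.norm_def, coe_restrict] at h
  exact h

/-- `p ∉ (inducedIdeal φ)²`: the ramification index is one. -/
theorem natCast_notMem_inducedIdeal_sq : (p : 𝓞 F) ∉ inducedIdeal φ ^ 2 := by
  intro h
  have h1 := norm_apply_le_of_mem_pow φ 2 _ h
  rw [map_natCast, map_natCast, Padic.norm_p] at h1
  have hpR : (1 : ℝ) < p := by exact_mod_cast hp.out.one_lt
  have h2 : (p : ℝ) ^ (-(2 : ℕ) : ℤ) < (p : ℝ)⁻¹ := by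
    rw [← zpow_neg_one]
    exact zpow_lt_zpow_right₀ hpR (by norm_num)
  exact absurd (h1.trans_lt h2) (lt_irrefl _)

/-- Every residue class modulo the induced ideal contains a rational integer. -/
theorem exists_int_sub_mem_inducedIdeal (x : 𝓞 F) : ∃ a : ℤ, x - a ∈ inducedIdeal φ := by
  obtain ⟨n, -, hn⟩ := PadicInt.exists_mem_range (restrict φ x)
  refine ⟨n, ?_⟩
  rw [inducedIdeal, Ideal.mem_comap, map_sub]
  simpa using hn

end induced

section degree

variable [NumberField F] (φ : F →+* ℚ_[p])

/-- The induced ideal is not zero (it contains `p`). -/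
theorem inducedIdeal_ne_bot : inducedIdeal φ ≠ ⊥ := by
  intro h
  have hmem := natCast_mem_inducedIdeal φ
  rw [h, Ideal.mem_bot] at hmem
  exact hp.out.ne_zero (by exact_mod_cast hmem)

/-- The prime of `𝓞 F` induced by `φ`, as a height-one prime. -/
noncomputable def inducedPrime : HeightOneSpectrum (𝓞 F) where
  asIdeal := inducedIdeal φ
  isPrime := inducedIdeal_isPrime φ
  ne_bot := inducedIdeal_ne_bot φ

/-- The ideal of the induced prime is `inducedIdeal φ`. -/
@[simp]
theorem inducedPrime_asIdeal : (inducedPrime φ).asIdeal = inducedIdeal φ := rfl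

/-- `x ∈ inducedPrime φ ↔ ‖φ x‖ < 1` — the place «induced by φ». -/
theorem mem_inducedPrime_iff (x : 𝓞 F) :
    x ∈ (inducedPrime φ).asIdeal ↔ ‖φ (algebraMap (𝓞 F) F x)‖ < 1 :=
  mem_inducedIdeal_iff φ x

/-- The induced prime lies over `(p)`. -/
instance inducedPrime_liesOver : (inducedPrime φ).asIdeal.LiesOver (Ideal.span {(p : ℤ)}) :=
  inducedIdeal_liesOver φ

/-- The ramification index of the induced prime over `p` is one. -/
theorem ramificationIdx_inducedIdeal : (inducedIdeal φ).ramificationIdx ℤ = 1 := by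
  rw [← Ideal.ramificationIdx'_eq_ramificationIdx (Ideal.span {(p : ℤ)}) (inducedIdeal φ)
    span_p_ne_bot]
  apply Ideal.ramificationIdx'_spec
  · rw [Ideal.map_span, Set.image_singleton, map_natCast, pow_one,
      Ideal.span_singleton_le_iff_mem]
    exact natCast_mem_inducedIdeal φ
  · rw [Ideal.map_span, Set.image_singleton, map_natCast, Ideal.span_singleton_le_iff_mem,
      show (1 + 1 : ℕ) = 2 from rfl]
    exact natCast_notMem_inducedIdeal_sq φ

/-- The inertia degree of the induced prime over `p` is one. -/
theorem inertiaDeg_inducedIdeal : (inducedIdeal φ).inertiaDeg ℤ = 1 := by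
  haveI : (Ideal.span {(p : ℤ)}).IsMaximal := isMaximal_span_p
  haveI : (inducedIdeal φ).IsMaximal := (inducedPrime φ).isMaximal
  rw [← Ideal.inertiaDeg'_eq_inertiaDeg (Ideal.span {(p : ℤ)}) (inducedIdeal φ),
    Ideal.inertiaDeg'_algebraMap]
  haveI : Nontrivial (𝓞 F ⧸ inducedIdeal φ) :=
    Ideal.Quotient.nontrivial_of_liesOver_of_isPrime (inducedIdeal φ) (Ideal.span {(p : ℤ)})
  letI : Field (ℤ ⧸ Ideal.span {(p : ℤ)}) := Ideal.Quotient.field _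
  refine (finrank_eq_one_iff_of_nonzero' (K := ℤ ⧸ Ideal.span {(p : ℤ)})
    (1 : 𝓞 F ⧸ inducedIdeal φ) one_ne_zero).mpr ?_
  intro v
  obtain ⟨x, rfl⟩ := Ideal.Quotient.mk_surjective v
  obtain ⟨a, ha⟩ := exists_int_sub_mem_inducedIdeal φ x
  refine ⟨Ideal.Quotient.mk _ (a : ℤ), ?_⟩
  rw [Algebra.smul_def, mul_one, Ideal.Quotient.algebraMap_mk_of_liesOver, Ideal.Quotient.eq]
  simpa using (Ideal.neg_mem_iff _).mpr ha

/-- The induced prime has degree one: `e · f = 1`. -/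
theorem degree_one_inducedPrime :
    (inducedPrime φ).asIdeal.ramificationIdx ℤ * (inducedPrime φ).asIdeal.inertiaDeg ℤ = 1 := by
  rw [inducedPrime_asIdeal, ramificationIdx_inducedIdeal, inertiaDeg_inducedIdeal, mul_one]

end degree

end Summit.Ventures.HodgeRepro2.T5DegreeOneEmbeddings
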